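import Summits.RiemannHypothesis.RiemannHypothesis.Theorems.WeilFormatCDataKitG
import Summits.RiemannHypothesis.RiemannHypothesis.Theorems.WeilFormatCTailEvenJMS
import Summits.RiemannHypothesis.RiemannHypothesis.Theorems.WeilFormatCTailOddJMS
import Literature.NumberTheory.LFunctions.YoshidaWindowGramTailMS
import HarnessLib

/-!
# Format C: the MEAN-SQUARE order-`J` tail feeds the generic kernel kit (bridges)

Helper file of the rh-explicit Weil-positivity programme (`--supports stmt-RiemannHypothesis-0098`; seat rh-explicit-weil-2),
RH-free, no definitions.  weil-10's `even_tailJMS_majorant_matrix` / `odd_tailJMS_majorant_matrix` restated in the `hU2E`/`hU2O`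
shape of `WeilFormatC.weilPositivityOn_of_kitG` with `U2E = Encl.U2EvenJMS …`, `U2O = Encl.U2OddJMS …` (part VIII-a); the sine
lower-bound data and their inequalities are passed through (a rung discharges them by kernel sine boxes, part VIII-b).
-/

set_option linter.dupNamespace false
set_option autoImplicit false

noncomputable section

open Complex Finset Matrix
open scoped Real BigOperators ArithmeticFunction.vonMangoldt

namespace Summit.RiemannHypothesis.RiemannHypothesis.Theorems.WeilFormatC

open Literature.NumberTheory.LFunctions Literature.NumberTheory.LFunctions.Yoshida1992
  Literature.NumberTheory.LFunctions.Yoshida1992.Encl Literature.Analysis.SpecialFunctions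

variable {a : ℝ}

/-- **The mean-square tail feeds the generic kit (even)**. -/
theorem U2EvenJMS_majorant (ha : 0 < a) {Be B3e : ℕ} (hBe : 1 ≤ Be) (hBBe : 2 * Be ≤ B3e) (hB3e : 2 ≤ B3e) (Je : ℕ)
    {θ η d0 : ℝ} (hθ : 0 < θ) (hη : 0 < η) (hd0 : 0 < d0)
    (s₁ : ℕ → ℝ) (sm sp : ℕ → ℕ → ℝ)
    (hs₁ : ∀ k ∈ weilPrimeIndex a, IsPrimePow k → 0 ≤ s₁ k ∧ s₁ k ≤ |Real.sin (π * Real.log k / a / 2)|)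
    (hsm : ∀ k ∈ weilPrimeIndex a, ∀ k' ∈ weilPrimeIndex a, IsPrimePow k → IsPrimePow k' → k ≠ k' →
      0 ≤ sm k k' ∧ sm k k' ≤ |Real.sin ((π * Real.log k / a - π * Real.log k' / a) / 2)|)
    (hsp : ∀ k ∈ weilPrimeIndex a, ∀ k' ∈ weilPrimeIndex a, IsPrimePow k → IsPrimePow k' →
      0 ≤ sp k k' ∧ sp k k' ≤ |Real.sin ((π * Real.log k / a + π * Real.log k' / a) / 2)|)
    (d : ℕ → ℝ) (hd : ∀ m, B3e ≤ m → d0 ≤ d m) (N : ℕ) (x : Fin Be → ℝ) :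
    ∑ m ∈ Finset.Ico B3e N, (∑ i : Fin Be, (if (i : ℕ) = 0 then gramCoeff a 0 m else if m = 0 then gramCoeff a i 0
      else (gramCoeff a i m + gramCoeff a i (-(m : ℤ))) / 2) * x i) ^ 2 / d m
      ≤ x ⬝ᵥ (Matrix.of fun i j : Fin Be ↦ U2EvenJMS a θ η d0 Be B3e Je s₁ sm sp i j) *ᵥ x := by
  have h := even_tailJMS_majorant_matrix ha hBe hBBe hB3e Je d hd0 hd hθ hη s₁ sm sp hs₁ hsm hsp N x
  refine h.trans (le_of_eq ?_)
  congr 2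
  ext i i'
  simp only [Matrix.of_apply]
  exact U2EvenJMS_fin a θ η d0 B3e Je s₁ sm sp i i'

/-- **The mean-square tail feeds the generic kit (odd)**. -/
theorem U2OddJMS_majorant (ha : 0 < a) {Bo B3o : ℕ} (hBo : 1 ≤ Bo) (hBBo : 2 * Bo ≤ B3o) (Jo : ℕ)
    {θ η d0 : ℝ} (hθ : 0 < θ) (hη : 0 < η) (hd0 : 0 < d0)
    (s₁ : ℕ → ℝ) (sm sp : ℕ → ℕ → ℝ)
    (hs₁ : ∀ k ∈ weilPrimeIndex a, IsPrimePow k → 0 ≤ s₁ k ∧ s₁ k ≤ |Real.sin (π * Real.log k / a / 2)|)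
    (hsm : ∀ k ∈ weilPrimeIndex a, ∀ k' ∈ weilPrimeIndex a, IsPrimePow k → IsPrimePow k' → k ≠ k' →
      0 ≤ sm k k' ∧ sm k k' ≤ |Real.sin ((π * Real.log k / a - π * Real.log k' / a) / 2)|)
    (hsp : ∀ k ∈ weilPrimeIndex a, ∀ k' ∈ weilPrimeIndex a, IsPrimePow k → IsPrimePow k' →
      0 ≤ sp k k' ∧ sp k k' ≤ |Real.sin ((π * Real.log k / a + π * Real.log k' / a) / 2)|)
    (d : ℕ → ℝ) (hd : ∀ l, B3o ≤ l → d0 ≤ d l) (N : ℕ) (x : Fin Bo → ℝ) :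
    ∑ l ∈ Finset.Ico B3o N, (∑ k : Fin Bo, ((gramCoeff a (((k : ℕ) : ℤ) + 1) ((l : ℤ) + 1)
      - gramCoeff a (((k : ℕ) : ℤ) + 1) (-((l : ℤ) + 1))) / 2) * x k) ^ 2 / d l
      ≤ x ⬝ᵥ (Matrix.of fun k k' : Fin Bo ↦ U2OddJMS a θ η d0 Bo B3o Jo s₁ sm sp k k') *ᵥ x := by
  have h := odd_tailJMS_majorant_matrix ha hBo hBBo Jo d hd0 hd hθ hη s₁ sm sp hs₁ hsm hsp N x
  refine h.trans (le_of_eq ?_)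
  congr 2
  ext k k'
  simp only [Matrix.of_apply]
  exact U2OddJMS_fin a θ η d0 B3o Jo s₁ sm sp k k'

end Summit.RiemannHypothesis.RiemannHypothesis.Theorems.WeilFormatC

end
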